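import Mathlib
import Summits.Ventures.PercRepro2.LocRows
import Summits.Ventures.PercRepro2.SwRow
import Summits.Ventures.PercRepro2.SwOut
import Summits.Ventures.PercRepro2.SwAllRow
import Summits.Ventures.PercRepro2.SwOutAll
import Summits.Ventures.PercRepro2.SwOutJunctionH1Defs
import Summits.Ventures.PercRepro2.SwOutJunctionH1Key
import Summits.Ventures.PercRepro2.SwOutJunctionH1Sw

/-!
# Instance: the claw junction (blind cell PercRepro2, night-4 g14, 2026-08-26;
proofs/NIGHT4-G11.md §5, proofs/NIGHT4-G12.md §3 COROLLARIES (b), proofs/NIGHT4-G14.md §6)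

The graph `c7_00084` of NIGHT4-G11.md — the first graph whose class carried an ORPHAN: the claw
`K_{1,3}` at the junction `u = 3` with leaves `4, 5, 6`, `h = 1` pendant at the leaf `4`, `l = 0`
joined to the three leaves, `o = 2` pendant at `l`.  The leaves `5, 6` are not adjacent to `h`:
the junction theorem of g11 (every neighbour of `u` adjacent to `h`) does not apply, the
simple-arm hypothesis (H1) does (the components of `5` and `6` in `G[U ∖ {h, u}]` are the
singletons, with no neighbour of `h`).  Row (SW) holds on it (`sw_claw`), by Theorem A.
-/

namespace Summit.Ventures.PercRepro2

namespace LocRows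

open Hull

variable {V : Type*} {E : Type*} [Fintype E] [DecidableEq E]

open scoped Classical

variable {ends : E → Sym2 V}

omit [Fintype E] [DecidableEq E] in
/-- A component of `G[U ∖ {h, u}]` of a vertex whose edges all leave `U ∖ {h, u}` is a singleton. -/
lemma compU_subset_singleton {U : Set V} {h u p : V}
    (hp : ∀ e x, ends e = s(p, x) → x ∉ U \ {h, u}) : compU ends U h u p ⊆ {p} := by
  intro v hv
  refine mem_of_conn_of_closed (ends := ends) (S := {p}) ?_ rfl hv
  intro a ha b hab
  rw [Set.mem_singleton_iff] at ha
  subst ha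
  obtain ⟨_, e, he, hends⟩ := openGraph_adj.1 hab
  exfalso
  have he' : e ∈ within ends (U \ {h, u}) := by simpa using he
  obtain ⟨x, hx, y, hy, hxy⟩ := he'
  rw [hends, Sym2.eq_iff] at hxy
  rcases hxy with ⟨_, h2⟩ | ⟨_, h2⟩
  · exact hp e b hends (by rw [h2]; exact hy)
  · exact hp e b hends (by rw [h2]; exact hx)

/-- The claw junction: `l = 0`, `h = 1`, `o = 2`, `u = 3`, leaves `4, 5, 6`. -/
def claw : Fin 8 → Sym2 (Fin 7)
  | 0 => s(3, 4) | 1 => s(3, 5) | 2 => s(3, 6) | 3 => s(4, 1) | 4 => s(4, 0) | 5 => s(5, 0)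
  | 6 => s(6, 0) | 7 => s(2, 0)

/-- (H1) for the claw in the region `{l}ᶜ`: the neighbour `4` of `u` is adjacent to `h`; the
neighbours `5, 6` are isolated in `G[U ∖ {h, u}]` and not adjacent to `h`. -/
theorem claw_H1 : H1 claw ({0}ᶜ) 1 3 := by
  intro e p hep
  fin_cases e
  · -- `p = 4`
    have hp : p = 4 := by
      simp only [claw, Sym2.eq_iff] at hep
      omega
    subst hp
    exact Or.inl ⟨3, rfl⟩
  · have hp : p = 5 := by
      simp only [claw, Sym2.eq_iff] at hep
      omega
    subst hp
    right
    intro q hq e' he'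
    have hq5 : q = 5 := compU_subset_singleton (by
      intro e x hex
      fin_cases e <;> simp only [claw, Sym2.eq_iff] at hex <;> simp <;> omega) hq
    subst hq5
    fin_cases e' <;> simp [claw] at he'
  · have hp : p = 6 := by
      simp only [claw, Sym2.eq_iff] at hep
      omega
    subst hp
    right
    intro q hq e' he'
    have hq6 : q = 6 := compU_subset_singleton (by
      intro e x hex
      fin_cases e <;> simp only [claw, Sym2.eq_iff] at hex <;> simp <;> omega) hq
    subst hq6
    fin_cases e' <;> simp [claw] at he'
  all_goals
    exfalso
    simp only [claw, Sym2.eq_iff] at hep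
    omega

/-- **Row (SW) on the claw junction** `c7_00084` (`l = 0`, `h = 1`, `o = 2`, the junction `u = 3`
with the pure leaves `5, 6`): Theorem A. -/
theorem sw_claw : Sw claw 0 1 2 := by
  refine sw_of_junctionH1 (l := 0) (h := 1) (o := 2) (u := 3) (by decide) ?_ ?_ (by decide) ?_
    claw_H1 ?_
  · intro e; fin_cases e <;> decide
  · intro e; fin_cases e <;> decide
  · intro e; fin_cases e <;> decide
  · intro x hx0 hx1 hx2 hx3
    fin_cases x
    · exact absurd rfl hx0
    · exact absurd rfl hx1
    · exact absurd rfl hx2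
    · exact absurd rfl hx3
    · exact ⟨4, rfl⟩
    · exact ⟨5, rfl⟩
    · exact ⟨6, rfl⟩

end LocRows

end Summit.Ventures.PercRepro2
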